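import Mathlib

/-!
# `NewtonTauWeak` (stmt-ValiantsHypothesis-5904), line `binomial-normal-form`: the halving recursion —
# from the halving inequality to the quasi-polynomial vertex bound (THEOREM W♯, stub `stub_levelVertsRecursion`)

Support file for the crux
`Summit.ValiantsHypothesis.ValiantsHypothesis.Theses.NewtonUnitEquations.NewtonTauWeak`, THEOREM W♯
(Gusfield halving), registered stub `stub_levelVertsRecursion`.

Setting.  For `N` items with weights `g : Fin N → ℕ` (`1 ≤ g j ≤ c`) and exponent vectors
`d : Fin N → (Fin 2 →₀ ℕ)`, the level set of level `v` is the finite set of subset sums `Σ_{j ∈ J} d j`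
over the index sets `J ⊆ Fin N` of weight `Σ_{j ∈ J} g j = v`; its vertex count `LV[N, g, d, v]` is the
number of extreme points of the convex hull of its real embedding in `ℝ²`.  The hypothesis `hH` of the
stub is the halving inequality (the neighbouring stubs, composed), for ALL block sizes `n₁, n₂`:
`LV (n₁+n₂) ≤ Σ_{v₁ ≤ c n₁} 2 · (LV n₁ … v₁ + LV n₂ … (v − v₁))`.  We conclude the quasi-polynomial
bound `LV[N, g, d, v] ≤ (8 c N + 4) ^ ⌈log₂ N⌉` (`Nat.clog 2 N`).

Proof.  `bound_pow : ∀ k N, N ≤ 2^k → LV[N, g, d, v] ≤ (4 c 2^k + 4)^k` by induction on `k`.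
Base `N ≤ 1`: two index sets of equal weight coincide (an element of one missing from the other forces
the other to be empty, of weight `0`, while the first has weight `≥ 1`), so the level set has at most
one point, and the extreme points of the hull of a set lie in the set.  Step: split `N = N/2 + (N − N/2)`
(both halves `≤ 2^k`), apply `hH`, bound each of the `c·(N/2) + 1` summands by `4 B_k` using the
induction hypothesis on both blocks, and `(4 c 2^k + 4) B_k ≤ (4 c 2^{k+1} + 4)^{k+1}`.  Finally take
`k := Nat.clog 2 N`: `N ≤ 2^k` (`Nat.le_pow_clog`) and `2^k < 2 N` for `N ≥ 2`
(`Nat.pow_lt_of_lt_clog`), so `4 c 2^k + 4 ≤ 8 c N + 4`; for `N ≤ 1` both sides are `(…)^0 = 1`.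
[folklore: Gusfield's halving / merge bound for parametric subset sums]

Main result: `stub_levelVertsRecursion` (the registered signature; hypothesis `hH` = the halving stub).
Helpers in the sub-namespace `LevelVertsRecursionAux` (no definitions, no named facts; Mathlib only);
`LV[N, g, d, v]` above is informal shorthand for the vertex-count expression of the registered stub.
-/

-- the namespace mandated for this Theorems file repeats the component `ValiantsHypothesis`
set_option linter.dupNamespace false

noncomputable section

open scoped BigOperators

namespace Summit.ValiantsHypothesis.ValiantsHypothesis.Theorems.NewtonUnitEquationsNewtonTauWeak

namespace LevelVertsRecursionAux

/-! ## §1 Base case: at most one item -/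

/-- On at most one item with positive weights, two index sets of equal weight agree elementwise:
every element of `J` lies in `J'`. [folklore] -/
theorem mem_of_weight_eq {N : ℕ} (hN : N ≤ 1) (g : Fin N → ℕ) (hg : ∀ j, 1 ≤ g j)
    {J J' : Finset (Fin N)} (h : ∑ j ∈ J, g j = ∑ j ∈ J', g j) {a : Fin N} (ha : a ∈ J) :
    a ∈ J' := by
  by_contra hna
  have hJ' : J' = ∅ := Finset.eq_empty_of_forall_notMem fun b hb => by
    have hba : b = a := Fin.ext (by have := a.isLt; have := b.isLt; omega)
    exact hna (hba ▸ hb)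
  rw [hJ', Finset.sum_empty] at h
  have h1 : g a ≤ ∑ j ∈ J, g j := Finset.single_le_sum (fun j _ => Nat.zero_le (g j)) ha
  have h2 := hg a
  omega

/-- On at most one item, each weight class of index sets has at most one element. [folklore] -/
theorem card_filter_le_one {N : ℕ} (hN : N ≤ 1) (g : Fin N → ℕ) (hg : ∀ j, 1 ≤ g j) (v : ℕ) :
    (Finset.univ.filter fun J : Finset (Fin N) => ∑ j ∈ J, g j = v).card ≤ 1 := by
  rw [Finset.card_le_one]
  intro J hJ J' hJ'
  simp only [Finset.mem_filter, Finset.mem_univ, true_and] at hJ hJ'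
  have h : ∑ j ∈ J, g j = ∑ j ∈ J', g j := hJ.trans hJ'.symm
  ext a
  exact ⟨mem_of_weight_eq hN g hg h, mem_of_weight_eq hN g hg h.symm⟩

/-- The hull of the image of a finite set in `ℝ²` has at most as many vertices as the set has
elements (extreme points of `convexHull A` lie in `A`). [folklore] -/
theorem ncard_extremePoints_le_card {α : Type*} (f : α → (Fin 2 → ℝ)) (S : Finset α) :
    (Set.extremePoints ℝ (convexHull ℝ (f '' (S : Set α)))).ncard ≤ S.card :=
  calc (Set.extremePoints ℝ (convexHull ℝ (f '' (S : Set α)))).ncard ≤ (f '' (S : Set α)).ncard :=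
        Set.ncard_le_ncard extremePoints_convexHull_subset (S.finite_toSet.image f)
    _ ≤ (S : Set α).ncard := Set.ncard_image_le S.finite_toSet
    _ = S.card := Set.ncard_coe_finset S

/-- Base case: on at most one item (positive weights), every level set has at most one vertex.
[folklore] -/
theorem LV_le_one {N : ℕ} (hN : N ≤ 1) (g : Fin N → ℕ) (hg : ∀ j, 1 ≤ g j)
    (d : Fin N → (Fin 2 →₀ ℕ)) (v : ℕ) :
    (Set.extremePoints ℝ (convexHull ℝ ((fun e : Fin 2 →₀ ℕ => fun i : Fin 2 => ((e i : ℕ) : ℝ)) ''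
      (((Finset.univ.filter fun J : Finset (Fin N) => ∑ j ∈ J, g j = v).image
        fun J => ∑ j ∈ J, d j : Finset (Fin 2 →₀ ℕ)) : Set (Fin 2 →₀ ℕ))))).ncard ≤ 1 :=
  (ncard_extremePoints_le_card _ _).trans (Finset.card_image_le.trans (card_filter_le_one hN g hg v))

/-! ## §2 The recursion -/

/-- Arithmetic of the induction step:
`(c n₁ + 1) · 2 · (B_k + B_k) ≤ (4 c 2^{k+1} + 4)^{k+1}` for `n₁ ≤ 2^k`, `B_k = (4 c 2^k + 4)^k`.
[folklore] -/
theorem step_arith (c n₁ k : ℕ) (h₁ : n₁ ≤ 2 ^ k) :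
    (c * n₁ + 1) * (2 * ((4 * c * 2 ^ k + 4) ^ k + (4 * c * 2 ^ k + 4) ^ k)) ≤
      (4 * c * 2 ^ (k + 1) + 4) ^ (k + 1) := by
  have hcn : c * n₁ ≤ c * 2 ^ k := Nat.mul_le_mul_left c h₁
  have hle : 4 * c * 2 ^ k + 4 ≤ 4 * c * 2 ^ (k + 1) + 4 := by
    rw [pow_succ]
    nlinarith [Nat.zero_le (c * 2 ^ k)]
  calc (c * n₁ + 1) * (2 * ((4 * c * 2 ^ k + 4) ^ k + (4 * c * 2 ^ k + 4) ^ k))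
      = (4 * (c * n₁) + 4) * (4 * c * 2 ^ k + 4) ^ k := by ring
    _ ≤ (4 * c * 2 ^ (k + 1) + 4) * (4 * c * 2 ^ (k + 1) + 4) ^ k :=
        Nat.mul_le_mul (by linarith [hcn, hle]) (Nat.pow_le_pow_left hle k)
    _ = (4 * c * 2 ^ (k + 1) + 4) ^ (k + 1) := (pow_succ' _ k).symm

/-- The recursion: under the halving inequality `hH` (for all block sizes), `N ≤ 2^k` items with
weights in `[1, c]` give level sets with at most `(4 c 2^k + 4)^k` vertices, by induction on `k`.
[folklore] -/
theorem bound_pow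
    (hH : ∀ (n₁ n₂ c v : ℕ) (g : Fin (n₁ + n₂) → ℕ), (∀ j, 1 ≤ g j ∧ g j ≤ c) →
      ∀ d : Fin (n₁ + n₂) → (Fin 2 →₀ ℕ),
      (Set.extremePoints ℝ (convexHull ℝ ((fun e : Fin 2 →₀ ℕ => fun i : Fin 2 => ((e i : ℕ) : ℝ)) ''
        (((Finset.univ.filter fun J : Finset (Fin (n₁ + n₂)) => ∑ j ∈ J, g j = v).image
          fun J => ∑ j ∈ J, d j : Finset (Fin 2 →₀ ℕ)) : Set (Fin 2 →₀ ℕ))))).ncard ≤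
        ∑ v₁ ∈ Finset.range (c * n₁ + 1), 2 *
          ((Set.extremePoints ℝ (convexHull ℝ ((fun e : Fin 2 →₀ ℕ => fun i : Fin 2 => ((e i : ℕ) : ℝ)) ''
            (((Finset.univ.filter fun J : Finset (Fin n₁) => ∑ j ∈ J, g (Fin.castAdd n₂ j) = v₁).image
              fun J => ∑ j ∈ J, d (Fin.castAdd n₂ j) : Finset (Fin 2 →₀ ℕ)) : Set (Fin 2 →₀ ℕ))))).ncard +
          (Set.extremePoints ℝ (convexHull ℝ ((fun e : Fin 2 →₀ ℕ => fun i : Fin 2 => ((e i : ℕ) : ℝ)) ''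
            (((Finset.univ.filter fun J : Finset (Fin n₂) => ∑ j ∈ J, g (Fin.natAdd n₁ j) = v - v₁).image
              fun J => ∑ j ∈ J, d (Fin.natAdd n₁ j) : Finset (Fin 2 →₀ ℕ)) : Set (Fin 2 →₀ ℕ))))).ncard))
    (k : ℕ) :
    ∀ N, N ≤ 2 ^ k → ∀ (c v : ℕ) (g : Fin N → ℕ), (∀ j, 1 ≤ g j ∧ g j ≤ c) →
      ∀ d : Fin N → (Fin 2 →₀ ℕ),
      (Set.extremePoints ℝ (convexHull ℝ ((fun e : Fin 2 →₀ ℕ => fun i : Fin 2 => ((e i : ℕ) : ℝ)) ''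
        (((Finset.univ.filter fun J : Finset (Fin N) => ∑ j ∈ J, g j = v).image
          fun J => ∑ j ∈ J, d j : Finset (Fin 2 →₀ ℕ)) : Set (Fin 2 →₀ ℕ))))).ncard ≤
        (4 * c * 2 ^ k + 4) ^ k := by
  induction k with
  | zero =>
    intro N hN c v g hg d
    simp only [pow_zero]
    exact LV_le_one (by simpa using hN) g (fun j => (hg j).1) d v
  | succ k ih =>
    intro N hN c v g hg d
    obtain ⟨n₁, n₂, rfl, h₁, h₂⟩ : ∃ n₁ n₂ : ℕ, N = n₁ + n₂ ∧ n₁ ≤ 2 ^ k ∧ n₂ ≤ 2 ^ k := by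
      rw [pow_succ] at hN
      exact ⟨N / 2, N - N / 2, by omega, by omega, by omega⟩
    refine (hH n₁ n₂ c v g hg d).trans ?_
    have hB : ∀ v₁ ∈ Finset.range (c * n₁ + 1),
        2 * ((Set.extremePoints ℝ (convexHull ℝ ((fun e : Fin 2 →₀ ℕ => fun i : Fin 2 => ((e i : ℕ) : ℝ)) ''
          (((Finset.univ.filter fun J : Finset (Fin n₁) => ∑ j ∈ J, g (Fin.castAdd n₂ j) = v₁).image
            fun J => ∑ j ∈ J, d (Fin.castAdd n₂ j) : Finset (Fin 2 →₀ ℕ)) : Set (Fin 2 →₀ ℕ))))).ncard +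
          (Set.extremePoints ℝ (convexHull ℝ ((fun e : Fin 2 →₀ ℕ => fun i : Fin 2 => ((e i : ℕ) : ℝ)) ''
            (((Finset.univ.filter fun J : Finset (Fin n₂) => ∑ j ∈ J, g (Fin.natAdd n₁ j) = v - v₁).image
              fun J => ∑ j ∈ J, d (Fin.natAdd n₁ j) : Finset (Fin 2 →₀ ℕ)) : Set (Fin 2 →₀ ℕ))))).ncard) ≤
          2 * ((4 * c * 2 ^ k + 4) ^ k + (4 * c * 2 ^ k + 4) ^ k) := fun v₁ _ =>
      Nat.mul_le_mul_left 2 (Nat.add_le_add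
        (ih n₁ h₁ c v₁ (fun j => g (Fin.castAdd n₂ j)) (fun j => hg _) fun j => d (Fin.castAdd n₂ j))
        (ih n₂ h₂ c (v - v₁) (fun j => g (Fin.natAdd n₁ j)) (fun j => hg _) fun j => d (Fin.natAdd n₁ j)))
    refine (Finset.sum_le_card_nsmul _ _ _ hB).trans ?_
    rw [Finset.card_range, smul_eq_mul]
    exact step_arith c n₁ k h₁

end LevelVertsRecursionAux

/-- THEOREM W♯ by halving (registered stub `stub_levelVertsRecursion` of the line
`binomial-normal-form`): if the halving inequality `hH` holds for all block sizes `n₁ n₂`, grades `c`,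
levels `v`, weights `1 ≤ g j ≤ c` and exponents `d`, then the level set of level `v` of the weighted
subset sums of `N` items has at most `(8 c N + 4) ^ ⌈log₂ N⌉` hull vertices.  Proof: `bound_pow` with
`k := Nat.clog 2 N` (`N ≤ 2^k`, `Nat.le_pow_clog`), and `2^k < 2N` for `N ≥ 2` (`Nat.pow_lt_of_lt_clog`);
`N ≤ 1` has exponent `0`. [folklore: Gusfield halving] -/
theorem stub_levelVertsRecursion
    (hH : ∀ (n₁ n₂ c v : ℕ) (g : Fin (n₁ + n₂) → ℕ), (∀ j, 1 ≤ g j ∧ g j ≤ c) →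
      ∀ d : Fin (n₁ + n₂) → (Fin 2 →₀ ℕ),
      (Set.extremePoints ℝ (convexHull ℝ ((fun e : Fin 2 →₀ ℕ => fun i : Fin 2 => ((e i : ℕ) : ℝ)) ''
        (((Finset.univ.filter fun J : Finset (Fin (n₁ + n₂)) => ∑ j ∈ J, g j = v).image
          fun J => ∑ j ∈ J, d j : Finset (Fin 2 →₀ ℕ)) : Set (Fin 2 →₀ ℕ))))).ncard ≤
        ∑ v₁ ∈ Finset.range (c * n₁ + 1), 2 *
          ((Set.extremePoints ℝ (convexHull ℝ ((fun e : Fin 2 →₀ ℕ => fun i : Fin 2 => ((e i : ℕ) : ℝ)) ''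
            (((Finset.univ.filter fun J : Finset (Fin n₁) => ∑ j ∈ J, g (Fin.castAdd n₂ j) = v₁).image
              fun J => ∑ j ∈ J, d (Fin.castAdd n₂ j) : Finset (Fin 2 →₀ ℕ)) : Set (Fin 2 →₀ ℕ))))).ncard +
          (Set.extremePoints ℝ (convexHull ℝ ((fun e : Fin 2 →₀ ℕ => fun i : Fin 2 => ((e i : ℕ) : ℝ)) ''
            (((Finset.univ.filter fun J : Finset (Fin n₂) => ∑ j ∈ J, g (Fin.natAdd n₁ j) = v - v₁).image
              fun J => ∑ j ∈ J, d (Fin.natAdd n₁ j) : Finset (Fin 2 →₀ ℕ)) : Set (Fin 2 →₀ ℕ))))).ncard))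
    (N c v : ℕ) (g : Fin N → ℕ) (hg : ∀ j, 1 ≤ g j ∧ g j ≤ c) (d : Fin N → (Fin 2 →₀ ℕ)) :
    (Set.extremePoints ℝ (convexHull ℝ ((fun e : Fin 2 →₀ ℕ => fun i : Fin 2 => ((e i : ℕ) : ℝ)) ''
      (((Finset.univ.filter fun J : Finset (Fin N) => ∑ j ∈ J, g j = v).image
        fun J => ∑ j ∈ J, d j : Finset (Fin 2 →₀ ℕ)) : Set (Fin 2 →₀ ℕ))))).ncard ≤
      (8 * c * N + 4) ^ (Nat.clog 2 N) := by
  refine (LevelVertsRecursionAux.bound_pow hH (Nat.clog 2 N) N (Nat.le_pow_clog one_lt_two N)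
    c v g hg d).trans ?_
  rcases Nat.lt_or_ge 1 N with hN | hN
  · obtain ⟨m, hm⟩ : ∃ m, Nat.clog 2 N = m + 1 :=
      ⟨Nat.clog 2 N - 1, by have := Nat.clog_pos one_lt_two hN; omega⟩
    have hk : 2 ^ m < N := Nat.pow_lt_of_lt_clog (by omega)
    rw [hm]
    apply Nat.pow_le_pow_left
    have h4 : 4 * c * 2 ^ m ≤ 4 * c * N := Nat.mul_le_mul_left _ hk.le
    rw [pow_succ]
    linarith
  · rw [Nat.clog_of_right_le_one hN 2]
    simp

end Summit.ValiantsHypothesis.ValiantsHypothesis.Theorems.NewtonUnitEquationsNewtonTauWeak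

end
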